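import Mathlib
import Literature.MathematicalPhysics.QuantumFieldTheory.Balaban1983to89.B5Projector144Torus
import Literature.MathematicalPhysics.QuantumFieldTheory.Balaban1983to89.B5RealFields

/-!
# T⁴ programme, node NE3 — BRIDGE-126, part 1: on pv15's fine torus, [B5]'s gauge-fixing projection `P` in the (1.70)
# form (pv15's `PcT`) and in the (1.44) form `G′Q′*(Q′G′²Q′*)⁻¹Q′G′` with CONCRETE matrix inverses agree between
# two-sided inverses `G′`, `(Q′G′²Q′*)⁻¹` (reader A's `GreenData`) AGREE on `1^⊥`

Fourteenth generation of the NE3 prover lineage P1 of the cell `pub-balaban`, file 2a.  The (3.49) reading of the lineage's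
one type asks, at `U = 1`, for the decay of the GAUGE HALF `gaugeDev j = η_j²·Re(∂P_j∂*)` of the flat remainder form
(`SliceFlatMassTerm`, p200480), `P_j` = pv15's `B5Value126.PcT` (Sect. C ∕ (1.70) form `Δ⁻¹Q′*(Q′Δ⁻²Q′*)⁻¹Q′Δ⁻¹`, pseudo-
inverse Laplacian).  The tree's n- and volume-UNIFORM (1.126) (b05's `B5DPD126Uniform.matrixP_decay_uniform`) is stated for
the (1.44) form on another carrier.  THIS FILE = first half of the dictionary «BRIDGE-126» (cell census G-B5-35 (iii)), on
pv15's carrier `Tor (fine n M)` only: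
 * §1 pv15's `LapSinv` (p. 22 «by Δ⁻¹ we denote its inverse on this subspace … equal to 0» on constants) and `Minv`
   SATISFY reader A's bundles of `B5Projector144` on b05-g13's typed torus (`B5Projector144Torus`): `Pker_mulVec_eq_avg`,
   **`lapData_LinvT`**, **`hci_CinvT`**, `ofLp_P138` (reader A's `P138 Δ⁻¹ Q′ Q′ᵀ (Q′Δ⁻²Q′*)⁻¹` IS `Re PcT`);
 * §2 **`PcT_apply_eq_P144`**: for EVERY `GreenData Δ Q′ Q′ᵀ a g c₂` and every `f ⊥ 1`, `Re PcT f = P144 Q′ Q′ᵀ g c₂ f`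
   (`B5Projector144.R138_eq_R144_of_orth` read for pv15's objects);
The companion file `SliceFlatGaugeGreen` (same generation) turns this into CONCRETE real matrices (`G′ = (Re Δ + a·Q′ᵀQ′)⁻¹`,
`(Q′G′²Q′ᵀ)⁻¹` as inverses of positive definite matrices) and the gradient sandwich `reM (∂·PcT·∂ᴴ) = Re ∂·P_G·(Re ∂)ᵀ`
— the form in which b04's torus Green kernel `K_T` and b05's `qggqRe`∕`kerRe`∕`KRe` can be matched entry by entry (part 2
of the bridge, the carrier dictionary `Tor (fine n N) ↔ Idx (n·N)`).  Nothing here is an estimate; NE3 is NOT proved.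

Honest framing: finite-T⁴ ultraviolet bookkeeping about MINIMISERS (rung (B)+1 of the cell's ladder); no conditional of the
cell (`BetaPertH`, (B), (B^μ)) is used or hidden; nothing bears on infinite volume, a mass gap, or the Clay problem.
ABSOLUTE RULE of the cell kept: inputs are kernel-proved tree modules only (`B5Projector144`, `B5Projector144Torus`, pv15's
`B5LaplaceInverse`∕`B5Substitution125`∕`B5Value126`∕`B5RealFields`); `[B5]` page pointers locate DEFINITIONS only.  No
`sorry`, no axioms beyond Mathlib's.  PLACEMENT (human rule 2026-08-19): cell work under `Summits/QuantumFields/BalabanUV/`;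
imports two Literature modules; moves nothing.  Records: `t4/T4-EST-U1b-OSC.md` v1.29 (RESULT 37), `t4/T4-EST-NE3-P1.md`
v2.28, GAPS G-ne3p1-43 of the cell `pub-balaban`.
-/

noncomputable section

open scoped InnerProductSpace Matrix ComplexConjugate
open Finset Matrix

namespace Summit.QuantumFields.BalabanUV.T4Continuum.SliceFlatGaugeProjection

open Literature.MathematicalPhysics.QuantumFieldTheory.Balaban1983to89
open Literature.MathematicalPhysics.QuantumFieldTheory.Balaban1983to89.B5Prop11Plancherel (Tor fine unitVec)
open Literature.MathematicalPhysics.QuantumFieldTheory.Balaban1983to89.B5Action121 (LapS GradOp sdiff shiftS)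
open Literature.MathematicalPhysics.QuantumFieldTheory.Balaban1983to89.B5Block118 (QsOp)
open Literature.MathematicalPhysics.QuantumFieldTheory.Balaban1983to89.B5LaplaceSpectral (LapS_const)
open Literature.MathematicalPhysics.QuantumFieldTheory.Balaban1983to89.B5LaplaceInverse
  (LapSinv Pker LapS_mul_LapSinv LapSinv_mul_LapS Pker_orth LapSinv_const LapSinv_conjTranspose)
open Literature.MathematicalPhysics.QuantumFieldTheory.Balaban1983to89.B5Substitution125
  (Mop Minv Mop_Minv_of_orth QsOp_adjoint_const)
open Literature.MathematicalPhysics.QuantumFieldTheory.Balaban1983to89.B5Value126 (PcT PcT_mulVec)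
open Literature.MathematicalPhysics.QuantumFieldTheory.Balaban1983to89.B5RealFields
  (reM cplx IsReal cplx_apply cplx_eq_zero_iff reM_conjTranspose reM_transpose_of_isHermitian isReal_LapS isReal_LapSinv
    isReal_Pker isReal_QsOp isReal_Minv isReal_PcT isReal_GradOp)
open Literature.MathematicalPhysics.QuantumFieldTheory.Balaban1983to89.B5GaussSectC (L2T DeltaT ofLp_DeltaT)
open Literature.MathematicalPhysics.QuantumFieldTheory.Balaban1983to89.B5Projector144
open Literature.MathematicalPhysics.QuantumFieldTheory.Balaban1983to89.B5Projector144Torus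

variable {d : ℕ} (n : ℕ) [NeZero n] (M : Fin d → ℕ) [hM : ∀ μ, NeZero (M μ)]

/-! ## §1  pv15's `Δ⁻¹` and `(Q′Δ⁻²Q′*)⁻¹` satisfy reader A's bundles on the typed torus -/
section Bundles

/-- `conj c = c` for a real lattice parameter. [folklore] -/
theorem conj_ofReal' (c : ℝ) : conj ((c : ℂ)) = (c : ℂ) := Complex.conj_ofReal c

/-- The spectral projection onto constants FIXES constants: `Pker (a·1) = a·1`. [folklore] -/
theorem Pker_mulVec_const (c a : ℂ) : Pker (fine n M) c *ᵥ (fun _ : Tor (fine n M) => a) = fun _ => a := by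
  have h1 : (LapSinv (fine n M) c * LapS (fine n M) c) *ᵥ (fun _ : Tor (fine n M) => a)
      = (1 - Pker (fine n M) c) *ᵥ (fun _ : Tor (fine n M) => a) := by rw [LapSinv_mul_LapS]
  rw [← Matrix.mulVec_mulVec, LapS_const, Matrix.mulVec_zero, Matrix.sub_mulVec, Matrix.one_mulVec] at h1
  exact (sub_eq_zero.mp h1.symm).symm

/-- **The spectral projection onto `ker Δ` IS the averaging projector** (`c ≠ 0`): `Pker f = (Σ_x f(x) / |T_η|)·1`.
[folklore] -/
theorem Pker_mulVec_eq_avg {c : ℂ} (hc : c ≠ 0) (f : Tor (fine n M) → ℂ) :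
    Pker (fine n M) c *ᵥ f = fun _ => (∑ x, f x) / (Fintype.card (Tor (fine n M)) : ℂ) := by
  set avg : ℂ := (∑ x, f x) / (Fintype.card (Tor (fine n M)) : ℂ) with havg
  have hcard : (Fintype.card (Tor (fine n M)) : ℂ) ≠ 0 := by
    exact_mod_cast (Fintype.card_pos (α := Tor (fine n M))).ne'
  set g : Tor (fine n M) → ℂ := fun x => f x - avg with hg
  have hsplit : f = g + fun _ => avg := by
    funext x; simp only [hg, Pi.add_apply, sub_add_cancel]
  have horth : ∑ x, g x = 0 := by
    simp only [hg, Finset.sum_sub_distrib, Finset.sum_const, Finset.card_univ, nsmul_eq_mul]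
    rw [havg, mul_div_cancel₀ _ hcard, sub_self]
  rw [hsplit, Matrix.mulVec_add, Pker_orth (fine n M) hc _ horth, zero_add, Pker_mulVec_const]

/-- pv15's `Δ⁻¹` (the pseudo-inverse `LapSinv`, zero on constants) on real fields of the typed torus. [model] [folklore] -/
def LinvT (c : ℝ) : L2T n M →ₗ[ℝ] L2T n M :=
  Matrix.toEuclideanLin (reM (LapSinv (fine n M) (c : ℂ)))

/-- pv15's `(Q′Δ⁻²Q′*)⁻¹` (`Minv`, the inverse on `1′^⊥`) on real fields of the block torus. [model] [folklore] -/
def CinvT (c : ℝ) : L2B M →ₗ[ℝ] L2B M :=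
  Matrix.toEuclideanLin (reM (Minv n M (c : ℂ)))

/-- Unfolding of `LinvT`. [folklore] -/
theorem ofLp_LinvT (c : ℝ) (x : L2T n M) :
    WithLp.ofLp (LinvT n M c x) = reM (LapSinv (fine n M) (c : ℂ)) *ᵥ WithLp.ofLp x := rfl

/-- Unfolding of `CinvT`. [folklore] -/
theorem ofLp_CinvT (c : ℝ) (φ : L2B M) :
    WithLp.ofLp (CinvT n M c φ) = reM (Minv n M (c : ℂ)) *ᵥ WithLp.ofLp φ := rfl

/-- `ofLp` of the averaging projector `proj1 1`. [folklore] -/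
theorem ofLp_proj1_oneT (x : L2T n M) :
    WithLp.ofLp (proj1 (oneT n M) x) = fun _ => (∑ i, WithLp.ofLp x i) / (Fintype.card (Tor (fine n M)) : ℝ) := by
  rw [proj1_apply, WithLp.ofLp_smul, inner_oneT, inner_oneT]
  funext i
  simp only [oneT, WithLp.ofLp_toLp, Pi.smul_apply, smul_eq_mul, Finset.sum_const, Finset.card_univ, nsmul_eq_mul]
  ring

/-- The real pseudo-inverse against the real Laplacian: `Re Δ · Re Δ⁻¹ u = u − avg(u)·1` (`c ≠ 0`). [folklore] -/
theorem reLapS_reLapSinv_mulVec {c : ℝ} (hc : c ≠ 0) (u : Tor (fine n M) → ℝ) :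
    reM (LapS (fine n M) (c : ℂ)) *ᵥ (reM (LapSinv (fine n M) (c : ℂ)) *ᵥ u)
      = u - fun _ => (∑ i, u i) / (Fintype.card (Tor (fine n M)) : ℝ) := by
  have hcC : (c : ℂ) ≠ 0 := by exact_mod_cast hc
  apply cplx_injective
  rw [(isReal_LapS (fine n M) (conj_ofReal' c)).cplx_mulVec, (isReal_LapSinv (fine n M) (conj_ofReal' c)).cplx_mulVec,
    Matrix.mulVec_mulVec, LapS_mul_LapSinv, Matrix.sub_mulVec, Matrix.one_mulVec, Pker_mulVec_eq_avg n M hcC]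
  funext i
  simp only [Pi.sub_apply, cplx_apply, Complex.ofReal_sub, Complex.ofReal_div, Complex.ofReal_sum,
    Complex.ofReal_natCast]

/-- `Re Δ⁻¹ · Re Δ u = u − avg(u)·1` (`c ≠ 0`). [folklore] -/
theorem reLapSinv_reLapS_mulVec {c : ℝ} (hc : c ≠ 0) (u : Tor (fine n M) → ℝ) :
    reM (LapSinv (fine n M) (c : ℂ)) *ᵥ (reM (LapS (fine n M) (c : ℂ)) *ᵥ u)
      = u - fun _ => (∑ i, u i) / (Fintype.card (Tor (fine n M)) : ℝ) := by
  have hcC : (c : ℂ) ≠ 0 := by exact_mod_cast hc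
  apply cplx_injective
  rw [(isReal_LapSinv (fine n M) (conj_ofReal' c)).cplx_mulVec, (isReal_LapS (fine n M) (conj_ofReal' c)).cplx_mulVec,
    Matrix.mulVec_mulVec, LapSinv_mul_LapS, Matrix.sub_mulVec, Matrix.one_mulVec, Pker_mulVec_eq_avg n M hcC]
  funext i
  simp only [Pi.sub_apply, cplx_apply, Complex.ofReal_sub, Complex.ofReal_div, Complex.ofReal_sum,
    Complex.ofReal_natCast]

/-- `Re Δ⁻¹ 1 = 0`. [folklore] -/
theorem reLapSinv_mulVec_one (c : ℝ) :
    reM (LapSinv (fine n M) (c : ℂ)) *ᵥ (fun _ : Tor (fine n M) => (1 : ℝ)) = 0 := by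
  apply cplx_injective
  rw [(isReal_LapSinv (fine n M) (conj_ofReal' c)).cplx_mulVec, cplx_one, LapSinv_const]
  exact ((cplx_eq_zero_iff _).mpr rfl).symm

/-- `Re Δ⁻¹` is a symmetric real matrix (`LapSinv` is Hermitian and real). [folklore] -/
theorem reLapSinv_transpose (c : ℝ) :
    (reM (LapSinv (fine n M) (c : ℂ)))ᵀ = reM (LapSinv (fine n M) (c : ℂ)) :=
  reM_transpose_of_isHermitian (LapSinv_conjTranspose (fine n M) (c : ℂ))

/-- **pv15's `Δ⁻¹` satisfies reader A's `LapData` on the typed torus** (`c ≠ 0`): Δ symmetric, `Δ1 = 0`,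
`ΔΔ⁻¹ = Δ⁻¹Δ = I − π₁`, `Δ⁻¹1 = 0` — [B5] p. 22's convention, kernel-checked for `LapSinv`. [folklore] -/
theorem lapData_LinvT {c : ℝ} (hc : c ≠ 0) : LapData (oneT n M) (DeltaT n M c) (LinvT n M c) where
  symm := DeltaT_symm n M c
  map_one := DeltaT_oneT n M c
  lap_inv x := by
    apply WithLp.ofLp_injective 2
    rw [ofLp_DeltaT, ofLp_LinvT, reLapS_reLapSinv_mulVec n M hc, WithLp.ofLp_sub, ofLp_proj1_oneT]
  inv_lap x := by
    apply WithLp.ofLp_injective 2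
    rw [ofLp_LinvT, ofLp_DeltaT, reLapSinv_reLapS_mulVec n M hc, WithLp.ofLp_sub, ofLp_proj1_oneT]
  inv_one := by
    apply WithLp.ofLp_injective 2
    rw [ofLp_LinvT, oneT, WithLp.ofLp_toLp, reLapSinv_mulVec_one, WithLp.ofLp_zero]

/-- Reader A's `AvgData` for the typed block average (b05-g13's three facts, bundled). [folklore] -/
theorem avgData_QT : AvgData (oneT n M) (oneB M) (QT n M) (QsT n M) :=
  ⟨QT_adj n M, QT_oneT n M, QT_perp n M⟩

/-- **pv15's `(Q′Δ⁻²Q′*)⁻¹` is a right inverse of `Q′Δ⁻²Q′ᵀ` on `1′^⊥`** (reader A's hypothesis `hci`; pv15's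
`Mop_Minv_of_orth`). [folklore] -/
theorem hci_CinvT {c : ℝ} (hc : c ≠ 0) (φ : L2B M) (hφ : inner ℝ (oneB M) φ = 0) :
    QT n M (LinvT n M c (LinvT n M c (QsT n M (CinvT n M c φ)))) = φ := by
  have hcC : (c : ℂ) ≠ 0 := by exact_mod_cast hc
  have hR := conj_ofReal' c
  apply WithLp.ofLp_injective 2
  rw [ofLp_QT, ofLp_LinvT, ofLp_LinvT, ofLp_QsT, ofLp_CinvT, ← reM_conjTranspose]
  apply cplx_injective
  rw [(isReal_QsOp n M).cplx_mulVec, (isReal_LapSinv (fine n M) hR).cplx_mulVec,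
    (isReal_LapSinv (fine n M) hR).cplx_mulVec, (isReal_QsOp n M).conjTranspose.cplx_mulVec,
    (isReal_Minv n M hR).cplx_mulVec]
  have hsum : ∑ y, cplx (WithLp.ofLp φ) y = 0 := by
    rw [sum_cplx, ← inner_oneB, hφ, Complex.ofReal_zero]
  have h := Mop_Minv_of_orth n M (c : ℂ) hcC (cplx (WithLp.ofLp φ)) hsum
  rw [B5Substitution125.Mop_mulVec] at h
  exact h

/-- **Reader A's (1.38)-form projection built from pv15's objects IS `Re PcT`**: `P138 Δ⁻¹ Q′ Q′ᵀ (Q′Δ⁻²Q′*)⁻¹ f =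
Re(Δ⁻¹Q′ᴴ(Q′Δ⁻²Q′ᴴ)⁻¹Q′Δ⁻¹) f`. [folklore] -/
theorem ofLp_P138 (c : ℝ) (f : L2T n M) :
    WithLp.ofLp (P138 (LinvT n M c) (QT n M) (QsT n M) (CinvT n M c) f)
      = reM (PcT n M (c : ℂ)) *ᵥ WithLp.ofLp f := by
  have hR := conj_ofReal' c
  rw [P138_apply, ofLp_LinvT, ofLp_QsT, ofLp_CinvT, ofLp_QT, ofLp_LinvT, ← reM_conjTranspose]
  apply cplx_injective
  rw [(isReal_LapSinv (fine n M) hR).cplx_mulVec, (isReal_QsOp n M).conjTranspose.cplx_mulVec,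
    (isReal_Minv n M hR).cplx_mulVec, (isReal_QsOp n M).cplx_mulVec, (isReal_LapSinv (fine n M) hR).cplx_mulVec,
    (isReal_PcT n M hR).cplx_mulVec, PcT_mulVec]

end Bundles

/-! ## §2  `Re PcT = P144` on `1^⊥` for every `GreenData` -/
section Agree

/-- **THE (1.70) FORM AND THE (1.44) FORM AGREE ON `1^⊥`, for pv15's objects**: for every two-sided inverses
`g = (Δ + aQ′ᵀQ′)⁻¹`, `c₂ = (Q′g²Q′ᵀ)⁻¹` (reader A's `GreenData`) and every real field `f ⊥ 1` on the typed torus,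
`Re PcT f = g Q′ᵀ c₂ Q′ g f` (`B5Projector144.R138_eq_R144_of_orth`). [folklore] -/
theorem PcT_apply_eq_P144 {c : ℝ} (hc : c ≠ 0) {a : ℝ} {g : L2T n M →ₗ[ℝ] L2T n M} {c₂ : L2B M →ₗ[ℝ] L2B M}
    (hG : GreenData (DeltaT n M c) (QT n M) (QsT n M) a g c₂) (f : L2T n M) (hf : inner ℝ (oneT n M) f = 0) :
    WithLp.toLp 2 (reM (PcT n M (c : ℂ)) *ᵥ WithLp.ofLp f) = P144 (QT n M) (QsT n M) g c₂ f := by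
  have h := R138_eq_R144_of_orth (lapData_LinvT n M hc) (avgData_QT n M) (oneT_ne_zero n M) (oneB_ne_zero M)
    (hci_CinvT n M hc) hG f hf
  rw [R138_apply, R144_apply, sub_right_inj] at h
  rw [← h]
  apply WithLp.ofLp_injective 2
  rw [WithLp.ofLp_toLp, ofLp_P138]

end Agree

end Summit.QuantumFields.BalabanUV.T4Continuum.SliceFlatGaugeProjection
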